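import Mathlib.MeasureTheory.Measure.Haar.Unique
import Mathlib.MeasureTheory.Measure.Prod
import Mathlib.MeasureTheory.Group.Prod
import HarnessLib

/-!
# Left Haar measure of an internal semidirect product `B = A ⋉ N`

Topic `NumberTheory/Automorphic`; namespace `Literature.NumberTheory.Automorphic`. Abstract measure
theory (Mathlib only) for the Borel subgroups `B(𝔸_K) = A(𝔸_K) N(𝔸_K)`, `B(F) = A(F) N(F)` of
`GL_n` (torus times unipotent radical) and the mirabolic/parabolic subgroups `P = M ⋉ U`: the second
half of "Haar measure in Iwasawa coordinates" (`HaarIntegralClosedCompact` supplies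
`∫_G = ∫_B ∫_K`; this file supplies `∫_B = ∫_A ∫_N`).

**Theorem** (`IsTopSemidirect.isHaarMeasure_map`). Let `B` be a locally compact second countable
Hausdorff group with closed subgroups `A`, `N` such that `A` normalises `N` and multiplication
`(a, n) ↦ a n` is a homeomorphism `A × N ≃ B` (an internal topological semidirect product). If `μ_A`,
`μ_N` are left Haar measures on `A`, `N`, then the image of `μ_A ⊗ μ_N` under `(a, n) ↦ a n` is a
left Haar measure on `B`; hence (`lintegral_eq_mul_lintegral_prod`) for every left Haar measure `μ_B`
there is `c ∈ (0, ∞)` with `∫_B f dμ_B = c ∫_A ∫_N f(a n) dμ_N(n) dμ_A(a)` for all measurable `f ≥ 0`.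

*Proof.* Left translation by `a₀ ∈ A` is `(a, n) ↦ (a₀ a, n)`; by `n₀ ∈ N` it is
`(a, n) ↦ (a, (a⁻¹ n₀ a) n)`, a skew product of left translations of `N` fibrewise over `A`
(Mathlib `MeasurePreserving.skew_product`); both preserve `μ_A ⊗ μ_N`, and `B = A N`. Finiteness on
compacts and positivity on opens transfer along the homeomorphism. This is the standard description of
the Haar measure of a semidirect product (Bourbaki, *Intégration* VII §2 no. 9; Deitmar–Echterhoff,
*Principles of Harmonic Analysis* (2014), §1.5; Getz–Hahn (2024), Ex. 3.1 for `B ≤ GL₂`); no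
Mathlib statement covers it (`lean search 'semidirect'` finds only the abstract group
`SemidirectProduct`), so it is tagged folklore.
-/

noncomputable section

open MeasureTheory Measure Set Filter Topology
open scoped ENNReal

namespace Literature.NumberTheory.Automorphic

/-! ### The datum and the algebra of left translations -/

section Algebra

variable {B : Type*} [Group B] [TopologicalSpace B] (A N : Subgroup B)

/-- **Internal topological semidirect product datum**: `A`, `N` are closed subgroups, multiplication
`A × N → B` is a homeomorphism `e` (so `A ∩ N = 1`, `A N = B`) and `A` normalises `N`. [folklore] -/
structure IsTopSemidirect (e : ↥A × ↥N ≃ₜ B) : Prop where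
  /-- `A` is closed. -/
  isClosed_left : IsClosed (A : Set B)
  /-- `N` is closed. -/
  isClosed_right : IsClosed (N : Set B)
  /-- `e (a, n) = a n`. -/
  apply_eq : ∀ (a : ↥A) (n : ↥N), e (a, n) = (a : B) * (n : B)
  /-- `A` normalises `N`: `a⁻¹ n a ∈ N`. -/
  conj_mem : ∀ (a : ↥A) (n : ↥N), (a : B)⁻¹ * (n : B) * (a : B) ∈ N

variable {A N} {e : ↥A × ↥N ≃ₜ B}

/-- The conjugate `a⁻¹ n₀ a ∈ N` as an element of `N`. [folklore] -/
def IsTopSemidirect.conjBy (_h : IsTopSemidirect A N e) (a : ↥A) (n₀ : ↥N) : ↥N :=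
  ⟨(a : B)⁻¹ * (n₀ : B) * (a : B), _h.conj_mem a n₀⟩

/-- `a (a⁻¹ n₀ a) = n₀ a`. [folklore] -/
theorem IsTopSemidirect.coe_mul_conjBy (h : IsTopSemidirect A N e) (a : ↥A) (n₀ : ↥N) :
    (a : B) * (h.conjBy a n₀ : B) = (n₀ : B) * (a : B) := by
  simp only [IsTopSemidirect.conjBy, ← mul_assoc, mul_inv_cancel, one_mul]

/-- `(a, n₀) ↦ a⁻¹ n₀ a` is continuous in `a`. [folklore] -/
theorem IsTopSemidirect.continuous_conjBy [IsTopologicalGroup B] (h : IsTopSemidirect A N e)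
    (n₀ : ↥N) : Continuous fun a : ↥A => h.conjBy a n₀ := by
  refine Continuous.subtype_mk ?_ _
  exact ((continuous_subtype_val.inv).mul continuous_const).mul continuous_subtype_val

/-- **Left translation by `a₀ ∈ A` in semidirect coordinates**: `a₀ · e(a, n) = e(a₀ a, n)`.
[folklore] -/
theorem IsTopSemidirect.mul_apply_left (h : IsTopSemidirect A N e) (a₀ a : ↥A) (n : ↥N) :
    (a₀ : B) * e (a, n) = e (a₀ * a, n) := by
  rw [h.apply_eq, h.apply_eq, Subgroup.coe_mul, mul_assoc]

/-- **Left translation by `n₀ ∈ N` in semidirect coordinates**: `n₀ · e(a, n) = e(a, (a⁻¹ n₀ a) n)`.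
[folklore] -/
theorem IsTopSemidirect.mul_apply_right (h : IsTopSemidirect A N e) (n₀ : ↥N) (a : ↥A) (n : ↥N) :
    (n₀ : B) * e (a, n) = e (a, h.conjBy a n₀ * n) := by
  rw [h.apply_eq, h.apply_eq, Subgroup.coe_mul, ← mul_assoc, ← mul_assoc, h.coe_mul_conjBy]

end Algebra

/-! ### The Haar measure -/

section Measure

variable {B : Type*} [Group B] [TopologicalSpace B] [IsTopologicalGroup B] [T2Space B]
  [SecondCountableTopology B] [LocallyCompactSpace B] [MeasurableSpace B] [BorelSpace B]
  {A N : Subgroup B} {e : ↥A × ↥N ≃ₜ B}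
  (μA : Measure ↥A) (μN : Measure ↥N) [IsHaarMeasure μA] [IsHaarMeasure μN]

omit [T2Space B] [BorelSpace B] in
/-- Haar measures on the closed subgroups `A`, `N` are σ-finite (closed subgroups of a second
countable locally compact group are σ-compact). [folklore] -/
theorem IsTopSemidirect.sigmaFinite (h : IsTopSemidirect A N e) : SigmaFinite μA ∧ SigmaFinite μN := by
  haveI : SecondCountableTopology ↥A := TopologicalSpace.Subtype.secondCountableTopology (A : Set B)
  haveI : SecondCountableTopology ↥N := TopologicalSpace.Subtype.secondCountableTopology (N : Set B)
  haveI : LocallyCompactSpace ↥A := h.isClosed_left.locallyCompactSpace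
  haveI : LocallyCompactSpace ↥N := h.isClosed_right.locallyCompactSpace
  exact ⟨inferInstance, inferInstance⟩

omit [T2Space B] in
/-- Left translation by `a₀ ∈ A` preserves `μ_A ⊗ μ_N` in semidirect coordinates. [folklore] -/
theorem IsTopSemidirect.measurePreserving_left (h : IsTopSemidirect A N e) (a₀ : ↥A) :
    MeasurePreserving (fun p : ↥A × ↥N => (a₀ * p.1, p.2)) (μA.prod μN) (μA.prod μN) := by
  haveI : SecondCountableTopology ↥A := TopologicalSpace.Subtype.secondCountableTopology (A : Set B)
  haveI : SecondCountableTopology ↥N := TopologicalSpace.Subtype.secondCountableTopology (N : Set B)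
  haveI : LocallyCompactSpace ↥A := h.isClosed_left.locallyCompactSpace
  haveI : LocallyCompactSpace ↥N := h.isClosed_right.locallyCompactSpace
  exact (measurePreserving_mul_left μA a₀).prod (MeasurePreserving.id μN)

omit [T2Space B] in
/-- Left translation by `n₀ ∈ N` preserves `μ_A ⊗ μ_N` in semidirect coordinates (skew product of
left translations of `N` over `A`). [folklore] -/
theorem IsTopSemidirect.measurePreserving_right (h : IsTopSemidirect A N e) (n₀ : ↥N) :
    MeasurePreserving (fun p : ↥A × ↥N => (p.1, h.conjBy p.1 n₀ * p.2)) (μA.prod μN)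
      (μA.prod μN) := by
  haveI : SecondCountableTopology ↥A := TopologicalSpace.Subtype.secondCountableTopology (A : Set B)
  haveI : SecondCountableTopology ↥N := TopologicalSpace.Subtype.secondCountableTopology (N : Set B)
  haveI : LocallyCompactSpace ↥A := h.isClosed_left.locallyCompactSpace
  haveI : LocallyCompactSpace ↥N := h.isClosed_right.locallyCompactSpace
  refine (MeasurePreserving.id μA).skew_product (g := fun a n => h.conjBy a n₀ * n) ?_ ?_
  · exact ((h.continuous_conjBy n₀).comp continuous_fst).measurable.mul measurable_snd
  · exact Eventually.of_forall fun a => (measurePreserving_mul_left μN (h.conjBy a n₀)).map_eq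

omit [T2Space B] in
/-- **The image of `μ_A ⊗ μ_N` under `(a, n) ↦ a n` is left invariant.** [folklore] -/
theorem IsTopSemidirect.isMulLeftInvariant_map (h : IsTopSemidirect A N e) :
    ((μA.prod μN).map e).IsMulLeftInvariant := by
  haveI : SecondCountableTopology ↥A := TopologicalSpace.Subtype.secondCountableTopology (A : Set B)
  haveI : SecondCountableTopology ↥N := TopologicalSpace.Subtype.secondCountableTopology (N : Set B)
  haveI : LocallyCompactSpace ↥A := h.isClosed_left.locallyCompactSpace
  haveI : LocallyCompactSpace ↥N := h.isClosed_right.locallyCompactSpace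
  have he : Measurable e := e.continuous.measurable
  -- invariance under `A` and under `N` separately
  have hA : ∀ a₀ : ↥A, ((μA.prod μN).map e).map ((a₀ : B) * ·) = (μA.prod μN).map e := by
    intro a₀
    rw [map_map (measurable_const_mul _) he]
    have hcomp : (((a₀ : B) * ·) ∘ e) = e ∘ fun p : ↥A × ↥N => (a₀ * p.1, p.2) := by
      funext p
      simp only [Function.comp_apply]
      rw [← h.mul_apply_left]
    rw [hcomp, ← map_map he (h.measurePreserving_left μA μN a₀).measurable,
      (h.measurePreserving_left μA μN a₀).map_eq]
  have hN : ∀ n₀ : ↥N, ((μA.prod μN).map e).map ((n₀ : B) * ·) = (μA.prod μN).map e := by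
    intro n₀
    rw [map_map (measurable_const_mul _) he]
    have hcomp : (((n₀ : B) * ·) ∘ e) = e ∘ fun p : ↥A × ↥N => (p.1, h.conjBy p.1 n₀ * p.2) := by
      funext p
      simp only [Function.comp_apply]
      rw [← h.mul_apply_right]
    rw [hcomp, ← map_map he (h.measurePreserving_right μA μN n₀).measurable,
      (h.measurePreserving_right μA μN n₀).map_eq]
  refine ⟨fun b => ?_⟩
  -- `b = a₀ n₀`
  obtain ⟨⟨a₀, n₀⟩, rfl⟩ := e.surjective b
  rw [h.apply_eq]
  have hsplit : (fun x : B => (a₀ : B) * (n₀ : B) * x) = ((a₀ : B) * ·) ∘ ((n₀ : B) * ·) := by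
    funext x
    simp only [Function.comp_apply, mul_assoc]
  rw [hsplit, ← map_map (measurable_const_mul _) (measurable_const_mul _), hN n₀, hA a₀]

/-- **Haar measure of an internal semidirect product.** For `B = A N` as in `IsTopSemidirect` and
left Haar measures `μ_A`, `μ_N`, the image of `μ_A ⊗ μ_N` under `(a, n) ↦ a n` is a left Haar
measure on `B` (left invariant, finite on compacts, positive on non-empty open sets — the last two
transported along the homeomorphism from the Haar measure `μ_A ⊗ μ_N` of the group `A × N`).
(Bourbaki, *Intégration* VII §2 no. 9; Deitmar–Echterhoff (2014), §1.5.) [folklore] -/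
theorem IsTopSemidirect.isHaarMeasure_map (h : IsTopSemidirect A N e) :
    IsHaarMeasure ((μA.prod μN).map e) := by
  haveI := h.isMulLeftInvariant_map μA μN
  haveI : SecondCountableTopology ↥A := TopologicalSpace.Subtype.secondCountableTopology (A : Set B)
  haveI : SecondCountableTopology ↥N := TopologicalSpace.Subtype.secondCountableTopology (N : Set B)
  haveI : LocallyCompactSpace ↥A := h.isClosed_left.locallyCompactSpace
  haveI : LocallyCompactSpace ↥N := h.isClosed_right.locallyCompactSpace
  have he : Measurable e := e.continuous.measurable
  refine { lt_top_of_isCompact := fun C hC => ?_, open_pos := fun U hU hne => ?_ }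
  · rw [map_apply he hC.measurableSet]
    exact (e.isCompact_preimage.2 hC).measure_lt_top
  · rw [map_apply he hU.measurableSet]
    exact (hU.preimage e.continuous).measure_ne_zero _ (hne.preimage e.surjective)

/-- **Integration in semidirect coordinates** (`[0, ∞]`-valued): for every left Haar measure
`μ_B` on `B = A N` there is a constant `c ∈ (0, ∞)` with
`∫_B f dμ_B = c ∫_A ∫_N f(a n) dμ_N(n) dμ_A(a)` for all measurable `f ≥ 0` (uniqueness of Haar
measure, `isMulLeftInvariant_eq_smul`, then Tonelli). [folklore] -/
theorem IsTopSemidirect.lintegral_eq_mul_lintegral_prod (h : IsTopSemidirect A N e)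
    (μB : Measure B) [IsHaarMeasure μB] :
    ∃ c : ℝ≥0∞, c ≠ 0 ∧ c ≠ ∞ ∧ ∀ f : B → ℝ≥0∞, Measurable f →
      ∫⁻ b, f b ∂μB = c * ∫⁻ a, ∫⁻ n, f ((a : B) * (n : B)) ∂μN ∂μA := by
  haveI := h.isHaarMeasure_map μA μN
  haveI : SecondCountableTopology ↥A := TopologicalSpace.Subtype.secondCountableTopology (A : Set B)
  haveI : SecondCountableTopology ↥N := TopologicalSpace.Subtype.secondCountableTopology (N : Set B)
  haveI : LocallyCompactSpace ↥A := h.isClosed_left.locallyCompactSpace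
  haveI : LocallyCompactSpace ↥N := h.isClosed_right.locallyCompactSpace
  have he : Measurable e := e.continuous.measurable
  refine ⟨haarScalarFactor μB ((μA.prod μN).map e), ?_, ENNReal.coe_ne_top, fun f hf => ?_⟩
  · exact_mod_cast (haarScalarFactor_pos_of_isHaarMeasure μB ((μA.prod μN).map e)).ne'
  · have hμ : μB = haarScalarFactor μB ((μA.prod μN).map e) • (μA.prod μN).map e :=
      isMulLeftInvariant_eq_smul μB _
    calc ∫⁻ b, f b ∂μB
        = ∫⁻ b, f b ∂(haarScalarFactor μB ((μA.prod μN).map e) • (μA.prod μN).map e) := by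
          rw [← hμ]
      _ = haarScalarFactor μB ((μA.prod μN).map e) * ∫⁻ p, (f ∘ e) p ∂(μA.prod μN) := by
          rw [lintegral_smul_measure, lintegral_map hf he]
          rfl
      _ = haarScalarFactor μB ((μA.prod μN).map e) *
            ∫⁻ a, ∫⁻ n, f ((a : B) * (n : B)) ∂μN ∂μA := by
          rw [lintegral_prod _ (hf.comp he).aemeasurable]
          congr 1
          refine lintegral_congr fun a => lintegral_congr fun n => ?_
          rw [Function.comp_apply, h.apply_eq]

end Measure

end Literature.NumberTheory.Automorphic
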